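import Summits.HubbardSuperconductivity.HubbardSuperconductivity.Theorems.AnisotropyChordTransferFibre3TwoHoleBSRobust
import Summits.HubbardSuperconductivity.HubbardSuperconductivity.Theorems.AnisotropyChordTransferFibre3TwoHoleBSCovariance
import Summits.HubbardSuperconductivity.HubbardSuperconductivity.Theorems.AnisotropyChordTransferFibre3TwoHoleGapReduce

/-!
# Route `AnisotropyChord` / H0 rotor rung: PROP BS entry points for PER-`L` CHECKERS — the REAL form of the certificate and `D₄` representatives

Eighth file of PROP BS (memo ROTOR-THEORY-21 §314(c), §319; theory seat `hubbard-h0-rotor-theory-1`).  A per-`L` Birman–Schwinger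
checker (interval arithmetic on the `10 × 10` Green matrices; p3 g3's CLAIM 21:27:18Z) delivers, for each representative separation
`s`, a REAL charge map `E` and a verified real inequality.  This file states exactly what such a checker must deliver and composes it
with p1 g24's representative machinery (`…Fibre3TwoHoleGapReduce.d4Orbit`):
* `greenMatRe` (the real Green matrix), `greenMatRe_eq` (`= Λ̃·11ᵀ − A`), `greenMatRe_apply` (`= 2·Gres L (2g) (pt p − pt q)`);
* ★ `matrixCert_of_real` / `matrixCert_of_real10`: a real `E` with `½|w|² ≤ 2(Eŵ)·ŵ − (Eŵ)ᵀ G̃_DD (Eŵ)` for real boundary vectors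
  (or for ten-slot vectors vanishing at the centres) gives `MatrixCert` (via `matrixCert_of_model` with `δ = 0`);
* `dualCert_zero_of_mem_orbit`, ★ `twoHoleGap_of_dualCert_reps` (dual certificates on a set `S` of representatives meeting every
  `D₄`-orbit ⇒ `TwoHoleGap L g`), ★★ `twoHoleGap_of_real_reps` (the same straight from real matrix certificates `E s`, `s ∈ S`).
So HOLE₂(θ) at a fixed `L ≥ 2` with `θε₁ < ε₁` is: a cover check (`decide`) + one real `10 × 10` inequality per representative.
Prover seat `hubbard-h0-rotor-p2` g2; helper for stmt-HubbardSuperconductivity-19089 (`--supports`, helper class).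
WHAT THIS IS NOT: nothing here proves superconductivity in the Hubbard model; the rotor TARGET as originally worded stays
FALSE (g15 verdict).  Interface bookkeeping for ONE input (HOLE₂) of ONE conditional reduction (rung 19089); it certifies no
`L` by itself.  Mathlib + tree imports only; no sorry, no axioms.
-/

set_option linter.dupNamespace false

noncomputable section

open scoped BigOperators
open Complex Finset

namespace Summit.HubbardSuperconductivity.HubbardSuperconductivity.Theorems.AnisotropyChord.Transfer.Fibre3

namespace TwoHoleBS

variable (L : ℕ) [NeZero L]

/-! ## Entry points for per-`L` checkers: the REAL form of the certificate, and `D₄` representatives (p1's `d4Orbit`) -/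

/-- the REAL Green matrix of the pair (the complex one has vanishing imaginary part). [folklore] -/
def greenMatRe (g : ℝ) (z₁ z₂ : Tor L) : Matrix (Fin 5 ⊕ Fin 5) (Fin 5 ⊕ Fin 5) ℝ :=
  Matrix.of fun p q => (greenMat L g z₁ z₂ p q).re

/-- `G̃_DD = Λ̃·11ᵀ − A` over `ℝ`. [folklore] -/
theorem greenMatRe_eq (g : ℝ) (z₁ z₂ : Tor L) : greenMatRe L g z₁ z₂ = capT L g • J10 - kerMat L g z₁ z₂ := by
  ext p q
  simp only [greenMatRe, Matrix.of_apply, greenMat_eq, Matrix.map_apply, Complex.ofReal_re]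

/-- entries of the real Green matrix: `2·Gres L (2g) (pt p − pt q)`. [folklore] -/
theorem greenMatRe_apply (g : ℝ) (z₁ z₂ : Tor L) (p q : Fin 5 ⊕ Fin 5) :
    greenMatRe L g z₁ z₂ p q = 2 * Gres L (2 * g) (bsPt L z₁ z₂ p - bsPt L z₁ z₂ q) := by
  simp only [greenMatRe, Matrix.of_apply, greenMat, greenW_re]

/-- ★ **REAL FORM of the certificate (entry point for interval-arithmetic checkers):** a real charge map `E` with
`½|w|² ≤ 2(Eŵ)·ŵ − (Eŵ)ᵀ·G̃_DD·(Eŵ)` for every real boundary vector `w` (`ŵ = pad w`) gives `MatrixCert L g z₁ z₂ E`. [folklore] -/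
theorem matrixCert_of_real (g : ℝ) (z₁ z₂ : Tor L) (E : Matrix (Fin 5 ⊕ Fin 5) (Fin 5 ⊕ Fin 5) ℝ)
    (hpos : ∀ w : Fin 4 ⊕ Fin 4 → ℝ,
      (1 / 2 : ℝ) * ∑ i : Fin 4 ⊕ Fin 4, w i ^ 2
        ≤ 2 * dotProduct (E.mulVec (pad w)) (pad w)
          - dotProduct (E.mulVec (pad w)) ((greenMatRe L g z₁ z₂).mulVec (E.mulVec (pad w)))) :
    MatrixCert L g z₁ z₂ (E.map Complex.ofReal) := by
  refine matrixCert_of_model L g z₁ z₂ E (kerMat L g z₁ z₂) 0 (fun p q => by simp) fun w => ?_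
  rw [zero_mul, add_zero, ← greenMatRe_eq]
  exact hpos w

/-- the same with ten-slot vectors vanishing at the centres (as a symmetric-matrix positivity statement would give it). [folklore] -/
theorem matrixCert_of_real10 (g : ℝ) (z₁ z₂ : Tor L) (E : Matrix (Fin 5 ⊕ Fin 5) (Fin 5 ⊕ Fin 5) ℝ)
    (hpos : ∀ x : Fin 5 ⊕ Fin 5 → ℝ, x (Sum.inl 0) = 0 → x (Sum.inr 0) = 0 →
      (1 / 2 : ℝ) * ∑ p : Fin 5 ⊕ Fin 5, x p ^ 2
        ≤ 2 * dotProduct (E.mulVec x) x - dotProduct (E.mulVec x) ((greenMatRe L g z₁ z₂).mulVec (E.mulVec x))) :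
    MatrixCert L g z₁ z₂ (E.map Complex.ofReal) := by
  refine matrixCert_of_real L g z₁ z₂ E fun w => ?_
  have h := hpos (pad w) (pad_centre w).1 (pad_centre w).2
  have hs : ∑ p : Fin 5 ⊕ Fin 5, pad w p ^ 2 = ∑ i : Fin 4 ⊕ Fin 4, w i ^ 2 := by
    have := sum_eq_sum_emb (F := fun p => ((pad w p ^ 2 : ℝ) : ℂ)) (by simp [(pad_centre w).1]) (by simp [(pad_centre w).2])
    simp only [pad_emb] at this
    exact_mod_cast this
  rw [hs] at h
  exact h

/-- every element of p1's `d4Orbit z` transports a dual certificate back to `(0, z)`. [folklore] -/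
theorem dualCert_zero_of_mem_orbit {g : ℝ} {z s : Tor L} (hs : s ∈ d4Orbit L z) (h : DualCert L g 0 s) :
    DualCert L g 0 z := by
  unfold d4Orbit at hs
  simp only [Finset.mem_insert, Finset.mem_singleton] at hs
  rcases hs with rfl | rfl | rfl | rfl | rfl | rfl | rfl | rfl
  · exact h
  · simpa using dualCert_neg L h
  · simpa [Prod.mk_zero_zero] using dualCert_swap L h
  · have h1 := dualCert_neg L h
    simp only [neg_zero, neg_neg] at h1
    simpa [Prod.mk_zero_zero] using dualCert_swap L h1
  · simpa [Prod.mk_zero_zero] using dualCert_mirror L h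
  · have h1 := dualCert_neg L h
    simp only [neg_zero, neg_neg] at h1
    simpa [Prod.mk_zero_zero] using dualCert_mirror L h1
  · have h1 := dualCert_swap L h
    simpa [Prod.mk_zero_zero] using dualCert_mirror L h1
  · have h1 := dualCert_mirror L h
    simpa [Prod.mk_zero_zero] using dualCert_swap L h1

/-- ★★ **representatives suffice (certificate level):** if `S` meets the `D₄`-orbit of every nonzero separation and each
`s ∈ S` has a dual certificate for the pair `(0, s)`, then `TwoHoleGap L g` (`2 ≤ L`, `g < ε₁`). [folklore] -/
theorem twoHoleGap_of_dualCert_reps (hL : 2 ≤ L) {g : ℝ} (hg : g < eps1 L) (S : Finset (Tor L))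
    (hcover : ∀ z : Tor L, z ≠ 0 → ∃ s ∈ S, s ∈ d4Orbit L z)
    (hS : ∀ s ∈ S, DualCert L g 0 s) : TwoHoleGap L g := by
  refine twoHoleGap_of_dualCert_origin L hL hg fun z hz => ?_
  obtain ⟨s, hsS, hs⟩ := hcover z hz
  exact dualCert_zero_of_mem_orbit L hs (hS s hsS)

/-- ★★ **HOLE₂ at a fixed `L` from real matrix certificates on representatives** (the form a per-`L` checker delivers). [folklore] -/
theorem twoHoleGap_of_real_reps (hL : 2 ≤ L) {g : ℝ} (hg : g < eps1 L) (S : Finset (Tor L))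
    (hcover : ∀ z : Tor L, z ≠ 0 → ∃ s ∈ S, s ∈ d4Orbit L z)
    (E : Tor L → Matrix (Fin 5 ⊕ Fin 5) (Fin 5 ⊕ Fin 5) ℝ)
    (hS : ∀ s ∈ S, ∀ w : Fin 4 ⊕ Fin 4 → ℝ,
      (1 / 2 : ℝ) * ∑ i : Fin 4 ⊕ Fin 4, w i ^ 2
        ≤ 2 * dotProduct ((E s).mulVec (pad w)) (pad w)
          - dotProduct ((E s).mulVec (pad w)) ((greenMatRe L g 0 s).mulVec ((E s).mulVec (pad w)))) :
    TwoHoleGap L g :=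
  twoHoleGap_of_dualCert_reps L hL hg S hcover fun s hs =>
    dualCert_of_matrixCert L (matrixCert_of_real L g 0 s (E s) (hS s hs))

end TwoHoleBS

end Summit.HubbardSuperconductivity.HubbardSuperconductivity.Theorems.AnisotropyChord.Transfer.Fibre3

end
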